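import Summits.ResolutionOfSingularities.ResolutionOfSingularities.Theses.HomologicalConductor
import Summits.ResolutionOfSingularities.ResolutionOfSingularities.Theorems.NoZeno.Negative.KernelDatumIrrational
import Summits.ResolutionOfSingularities.ResolutionOfSingularities.Theorems.NoZeno.Negative.SurfaceKernelHabitat

/-!
# Crux `NoZeno` (stmt-ResolutionOfSingularities-16483) — the H-irr kernel datum is ABHYANKAR:
# `ratRank (wtRing k) = 2`, transcendence defect `0`

Route `ResolutionOfSingularities/HomologicalConductor`, crux
`Summit.ResolutionOfSingularities.ResolutionOfSingularities.Theses.HomologicalConductor.NoZeno`,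
line `birth`, open stub `stub_kernelRankOne` (surface case, K4.4). Negative lane (`--supports` the
crux item): a small-model fact, no Theses decl is asserted; OURS (res-L0-w44-tri-1, BARRIER &
DEFECT triage calibration).

`HIrrDatum.hIrr_datum` (`KernelDatumIrrational.lean`) built the kernel datum
`(O, A) = (wtRing k, k[x⁻¹, y⁻¹])` on `k(x, y)`; `surfaceKernel_habitat`
(`SurfaceKernelHabitat.lean`) says every surface kernel is either ABHYANKAR (`ratRank 2`,
defect `0`) or DEFECT (`ratRank 1`, transcendence defect `1`). Here: `wtRing k` is Abhyankar —
the values of `x` and `y` are `ℤ`-independent in the value group (`log`-values `1` and `√2`,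
`√2` irrational), so `ratRank (wtRing k) ≥ 2` (`two_le_ratRank_wtRing`), whence
`hIrr_habitat : residueTrdeg = 0 ∧ ratRank = 2 ∧ transcendenceDefect = 0`. Consequently the
H-irr datum tests the Abhyankar disjunct ONLY; the defect disjunct (value group `ℤ[1/p]`-like,
Artin–Schreier towers) needs a separate habitat — the triage's "second, disjoint check".

Kernel-only (axioms `propext`, `Classical.choice`, `Quot.sound`); no `def`, no named fact.
-/

set_option linter.dupNamespace false

noncomputable section

open MvPolynomial

namespace Summit.ResolutionOfSingularities.ResolutionOfSingularities.Theorems.NoZeno.Negative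

namespace HIrrDatum

open Summit.ResolutionOfSingularities.ResolutionOfSingularities.Theorems.RankOneTermination.Negative
open Summit.ResolutionOfSingularities.ResolutionOfSingularities.Theorems.RankOneTermination.Negative.MonomialValuation
open Literature.AlgebraicGeometry.Resolution

variable (k : Type) [Field k]

/-- An element of valuation `1` for the valuation ring `wtRing k` has `wtVal`-value `1`.
[folklore] -/
theorem wtVal_eq_one_of_valuation_eq_one {w : RatF k} (h : (wtRing k).valuation w = 1) :
    wtVal k w = 1 := by
  have hw : w ∈ wtRing k := ((wtRing k).valuation_le_one_iff w).mp h.le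
  have hu : IsUnit (⟨w, hw⟩ : wtRing k) := ((wtRing k).valuation_eq_one_iff _).mpr h
  exact (isUnit_iff_wtVal_eq_one k ⟨w, hw⟩).mp hu

/-- The values of `x` and `y` are `ℤ`-independent in the value group of `wtRing k`
(`log`-values `1` and `√2`, and `√2` is irrational): `ratRank (wtRing k) ≥ 2`. [folklore] -/
theorem two_le_ratRank_wtRing : (2 : Cardinal) ≤ ratRank (wtRing k) := by
  have h0 : ∀ i : Fin 2, (wtRing k).valuation (algebraMap (Pol k) (RatF k) (X i)) ≠ 0 :=
    fun i => (map_ne_zero _).mpr (algebraMap_X_ne_zero k i)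
  let γ : Fin 2 → (ValuationSubring.ValueGroup (wtRing k))ˣ := fun i => Units.mk0 _ (h0 i)
  have hli : LinearIndependent ℤ ![Additive.ofMul (γ 0), Additive.ofMul (γ 1)] := by
    rw [LinearIndependent.pair_iff]
    intro s t hst
    have h1 : (γ 0) ^ s * (γ 1) ^ t = 1 := by
      have := congrArg Additive.toMul hst
      simpa [toMul_add, toMul_zsmul] using this
    have h2 : (wtRing k).valuation ((algebraMap (Pol k) (RatF k) (X 0)) ^ s *
        (algebraMap (Pol k) (RatF k) (X 1)) ^ t) = 1 := by
      have := congrArg (fun u : (ValuationSubring.ValueGroup (wtRing k))ˣ =>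
        (u : ValuationSubring.ValueGroup (wtRing k))) h1
      simpa [γ, map_mul, map_zpow₀, Units.val_mul, Units.val_zpow_eq_zpow_val] using this
    have h3 := wtVal_eq_one_of_valuation_eq_one k h2
    rw [map_mul, map_zpow₀, map_zpow₀, wtVal_X, wtVal_X] at h3
    -- take logarithms: `s * 1 + t * √2 = 0`
    have h4 : (s : ℝ) + t * Real.sqrt 2 = 0 := by
      have h := congrArg (fun r : NNReal => Real.log (r : ℝ)) h3
      simp only [NNReal.coe_mul, NNReal.coe_zpow, NNReal.coe_one, Real.log_one, coe_expWt] at h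
      rw [Real.log_mul (zpow_ne_zero _ (Real.exp_ne_zero _)) (zpow_ne_zero _ (Real.exp_ne_zero _)),
        Real.log_zpow, Real.log_zpow, Real.log_exp, Real.log_exp] at h
      have hw0 : wt (Finsupp.single (0 : Fin 2) 1) = 1 := by simp [wt]
      have hw1 : wt (Finsupp.single (1 : Fin 2) 1) = Real.sqrt 2 := by simp [wt]
      rw [hw0, hw1, mul_one] at h
      exact h
    by_cases ht : t = 0
    · subst ht
      simp only [Int.cast_zero, zero_mul, add_zero, Int.cast_eq_zero] at h4
      exact ⟨h4, rfl⟩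
    · exfalso
      apply irrational_sqrt_two.ne_rational (-s) t
      have ht' : (t : ℝ) ≠ 0 := by exact_mod_cast ht
      rw [eq_div_iff ht', Int.cast_neg]
      linarith
  have := hli.cardinal_le_rank
  simpa [ratRank] using this

/-- `k(x, y) / k` is finitely generated as a field. [folklore] -/
theorem fg_top_RatF : (⊤ : IntermediateField k (RatF k)).FG :=
  IntermediateField.fg_top_of_isFractionRing_of_finiteType k (Pol k) (RatF k)

/-- **H-irr habitat certificate.** `wtRing k` (value group `ℤ + ℤ√2`) is in the ABHYANKAR habitat
of `surfaceKernel_habitat`: residual transcendence degree `0`, rational rank `2`, transcendence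
defect `0` — NOT a defect valuation. [folklore] -/
theorem hIrr_habitat :
    residueTrdeg k (wtRing k) (algebraMap_mem_wtRing k) = 0 ∧ ratRank (wtRing k) = 2 ∧
      transcendenceDefect k (wtRing k) (algebraMap_mem_wtRing k) = 0 := by
  obtain ⟨h0, h⟩ := surfaceKernel_habitat (wtRing k) (algebraMap_mem_wtRing k) (fg_top_RatF k)
    (wtRing_ne_top k) (not_isNoetherianRing_wtRing k) (trdeg_RatF k)
  rcases h with ⟨h2, hD⟩ | ⟨h1, -⟩
  · exact ⟨h0, h2, hD⟩
  · exfalso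
    have h := two_le_ratRank_wtRing k
    rw [h1] at h
    exact absurd h (by norm_num)

end HIrrDatum

end Summit.ResolutionOfSingularities.ResolutionOfSingularities.Theorems.NoZeno.Negative

end
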